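import Summits.Ventures.PercRepro.Induction
import Summits.Ventures.PercRepro.ConditionalSums
import Summits.Ventures.PercRepro.SMC
import Summits.Ventures.PercRepro.MarkedMerge

/-!
# The single-merge concavity (SMC) principle

Let `G` be a finite multigraph with edge probabilities `p`, `m : Fin k → V` a marking, and
`Π(ω) = G.markedPartition ω m` the partition of the marked indices induced by the open clusters of
`ω`.  For a kernel `A : Setoid (Fin k) → Setoid (Fin k) → ℝ` the quadratic form of `A` at the
law of `Π` is `G.quadForm p m A = Σ_{ω,ω'} w_p(ω) w_p(ω') A(Π(ω), Π(ω'))`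
(`Summits.Ventures.PercRepro.SMC`).

**Theorem (`smc_principle`)**: if `A` satisfies the SMC condition — `A σ σ ≥ 0` for every
partition `σ`, and `A τ τ' - A τ σ' - A σ τ' + A σ σ' ≤ 0` whenever `(σ, τ)` and `(σ', τ')` are
single merges (`τ` arises from `σ` by merging two blocks) — then `G.quadForm p m A ≥ 0` for every
finite multigraph, every `p ∈ [0, 1]^E` and every marking.  This is Theorem 7 of
`proofs/P4-pairsum.md` and the mechanism behind the pair-sum inequality.

Proof.  Induction on the number of edges with `p e ∉ {0, 1}` (`induction_free`).  Under a point
mass the form is `A(Π(σ), Π(σ)) ≥ 0`.  For the step, conditioning on one edge `e` writes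
`w_p = t w₁ + (1 - t) w₀` (`t = p e`, `w₁ = w_{p[e:=1]}`, `w₀ = w_{p[e:=0]}`), so the form is
`t² S₁₁ + t(1-t)(S₁₀ + S₀₁) + (1-t)² S₀₀ = (1-t) S₀₀ + t S₁₁ - t(1-t) c₂` with
`c₂ = S₁₁ - S₁₀ - S₀₁ + S₀₀`, where `S_{ab}` is the double sum with weights `w_a, w_b`.  Both
`S₁₁`, `S₀₀` are forms at probability vectors with one free edge fewer, hence `≥ 0` by induction,
and `c₂ = Σ_{η,η'} w₀(η) w₀(η') [A(Π(η¹),Π(η'¹)) - A(Π(η¹),Π(η'⁰)) - A(Π(η⁰),Π(η'¹)) + A(Π(η⁰),Π(η'⁰))]`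
(`η¹`, `η⁰` = `η` with `e` opened / closed; `sum_weight_update_one`, `sum_weight_update_zero`).
Opening one edge merges at most two open clusters (`conn_update_true_iff`), so
`(Π(η⁰), Π(η¹))` is the identity or a single merge (`markedPartition_update_true`,
`Summits.Ventures.PercRepro.MarkedMerge`); in the first
case the bracket vanishes, in the second it is `≤ 0` by the SMC condition.  Hence `c₂ ≤ 0`.
-/

namespace PercRepro

open Finset

/-! ### Bilinear double sums and the one-edge split -/

section DoubleSum

variable {E : Type*} [Fintype E] [DecidableEq E]

/-- The double sum `Σ_{ω,ω'} u ω * v ω' * F ω ω'`. -/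
def dsum (u v : Config E → ℝ) (F : Config E → Config E → ℝ) : ℝ :=
  ∑ ω, ∑ ω', u ω * v ω' * F ω ω'

/-- **One-edge split** of the double sum with weights `w_p, w_p`: with `t = p e` and
`w₁ = w_{p[e:=1]}`, `w₀ = w_{p[e:=0]}`,
`S(w_p, w_p) = t² S(w₁,w₁) + t(1-t) S(w₁,w₀) + (1-t)t S(w₀,w₁) + (1-t)² S(w₀,w₀)`. -/
theorem dsum_weight_split (p : E → ℝ) (e : E) (F : Config E → Config E → ℝ) :
    dsum (weight p) (weight p) F =
      p e * p e * dsum (weight (Function.update p e 1)) (weight (Function.update p e 1)) F +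
        p e * (1 - p e) * dsum (weight (Function.update p e 1)) (weight (Function.update p e 0)) F +
        (1 - p e) * p e * dsum (weight (Function.update p e 0)) (weight (Function.update p e 1)) F +
        (1 - p e) * (1 - p e) *
          dsum (weight (Function.update p e 0)) (weight (Function.update p e 0)) F := by
  have hw : weight p = fun ω => p e * weight (Function.update p e 1) ω +
      (1 - p e) * weight (Function.update p e 0) ω := funext (weight_split p e)
  rw [hw]
  unfold dsum
  simp only [Finset.mul_sum, ← Finset.sum_add_distrib]
  refine Finset.sum_congr rfl fun ω _ => Finset.sum_congr rfl fun ω' _ => ?_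
  ring

/-- Reindexing a weighted sum under `p[e := b]` (`b ∈ {0, 1}` as a `Bool`). -/
theorem sum_weight_update (p : E → ℝ) (e : E) (b : Bool) (F : Config E → ℝ) :
    ∑ ω, weight (Function.update p e (if b then 1 else 0)) ω * F ω =
      ∑ η, weight (Function.update p e 0) η * F (Function.update η e b) := by
  cases b
  · simpa using sum_weight_update_zero p e F
  · simpa using sum_weight_update_one p e F

/-- The double sum with weights `w_{p[e:=b]}, w_{p[e:=b']}` as a double sum with weights
`w₀, w₀` over configurations seen with `e` set to `b`, `b'`. -/
theorem dsum_weight_update (p : E → ℝ) (e : E) (b b' : Bool) (F : Config E → Config E → ℝ) :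
    dsum (weight (Function.update p e (if b then 1 else 0)))
        (weight (Function.update p e (if b' then 1 else 0))) F =
      ∑ η, ∑ η', weight (Function.update p e 0) η * weight (Function.update p e 0) η' *
        F (Function.update η e b) (Function.update η' e b') := by
  unfold dsum
  have h1 : ∀ ω, (∑ ω', weight (Function.update p e (if b then 1 else 0)) ω *
      weight (Function.update p e (if b' then 1 else 0)) ω' * F ω ω') =
      weight (Function.update p e (if b then 1 else 0)) ω *
        ∑ η', weight (Function.update p e 0) η' * F ω (Function.update η' e b') := by
    intro ω
    rw [← sum_weight_update p e b' (fun ω' => F ω ω'), Finset.mul_sum]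
    refine Finset.sum_congr rfl fun ω' _ => ?_
    ring
  simp only [h1]
  rw [sum_weight_update p e b
    (fun ω => ∑ η', weight (Function.update p e 0) η' * F ω (Function.update η' e b'))]
  refine Finset.sum_congr rfl fun η _ => ?_
  rw [Finset.mul_sum]
  refine Finset.sum_congr rfl fun η' _ => ?_
  ring

/-- **The second-order coefficient is nonpositive**: if the "second difference" of `F` along the
edge `e` is pointwise `≤ 0`, then `S₁₁ - S₁₀ - S₀₁ + S₀₀ ≤ 0`. -/
theorem dsum_second_difference_nonpos {p : E → ℝ} (hp : IsProb p) (e : E)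
    (F : Config E → Config E → ℝ)
    (hF : ∀ η η' : Config E,
      F (Function.update η e true) (Function.update η' e true) -
          F (Function.update η e true) (Function.update η' e false) -
          F (Function.update η e false) (Function.update η' e true) +
          F (Function.update η e false) (Function.update η' e false) ≤ 0) :
    dsum (weight (Function.update p e 1)) (weight (Function.update p e 1)) F -
        dsum (weight (Function.update p e 1)) (weight (Function.update p e 0)) F -
        dsum (weight (Function.update p e 0)) (weight (Function.update p e 1)) F +
        dsum (weight (Function.update p e 0)) (weight (Function.update p e 0)) F ≤ 0 := by
  have h11 := dsum_weight_update p e true true F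
  have h10 := dsum_weight_update p e true false F
  have h01 := dsum_weight_update p e false true F
  have h00 := dsum_weight_update p e false false F
  simp only [Bool.false_eq_true, if_true, if_false] at h11 h10 h01 h00
  rw [h11, h10, h01, h00]
  simp only [← Finset.sum_sub_distrib, ← Finset.sum_add_distrib]
  have hw : ∀ η, 0 ≤ weight (Function.update p e 0) η :=
    fun η => weight_nonneg (hp.update e (by norm_num)) η
  refine Finset.sum_nonpos fun η _ => Finset.sum_nonpos fun η' _ => ?_
  have := mul_nonpos_of_nonneg_of_nonpos (mul_nonneg (hw η) (hw η')) (hF η η')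
  linarith

/-- **The one-edge step for a double sum**: if the second difference of `F` along `e` is
pointwise `≤ 0` and the double sums at `p[e:=1]`, `p[e:=0]` are nonnegative, so is the one at `p`
(concavity in `p e`). -/
theorem dsum_step {p : E → ℝ} (hp : IsProb p) (e : E) (F : Config E → Config E → ℝ)
    (hF : ∀ η η' : Config E,
      F (Function.update η e true) (Function.update η' e true) -
          F (Function.update η e true) (Function.update η' e false) -
          F (Function.update η e false) (Function.update η' e true) +
          F (Function.update η e false) (Function.update η' e false) ≤ 0)
    (h1 : 0 ≤ dsum (weight (Function.update p e 1)) (weight (Function.update p e 1)) F)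
    (h0 : 0 ≤ dsum (weight (Function.update p e 0)) (weight (Function.update p e 0)) F) :
    0 ≤ dsum (weight p) (weight p) F := by
  have hc := dsum_second_difference_nonpos hp e F hF
  have ht := hp e
  rw [dsum_weight_split p e F]
  nlinarith [mul_nonneg (mul_nonneg ht.1 (sub_nonneg.2 ht.2)) (neg_nonneg.2 hc),
    mul_nonneg ht.1 h1, mul_nonneg (sub_nonneg.2 ht.2) h0]

/-- Under a point mass the double sum is the diagonal value. -/
theorem dsum_detWeights (σ : Config E) (F : Config E → Config E → ℝ) :
    dsum (weight (detWeights σ)) (weight (detWeights σ)) F = F σ σ := by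
  unfold dsum
  rw [Finset.sum_eq_single σ]
  · rw [Finset.sum_eq_single σ]
    · simp [weight_detWeights]
    · intro ω' _ hω'
      simp [weight_detWeights, hω']
    · simp
  · intro ω _ hω
    simp [weight_detWeights, hω]
  · simp

/-- **The abstract single-flip principle**: if `F ω ω ≥ 0` for all `ω` and the second difference
of `F` along every edge is pointwise `≤ 0`, then `Σ_{ω,ω'} w_p(ω) w_p(ω') F ω ω' ≥ 0` for every
probability vector `p`. -/
theorem dsum_nonneg_of_second_difference (F : Config E → Config E → ℝ)
    (hdiag : ∀ ω, 0 ≤ F ω ω)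
    (hF : ∀ (e : E) (η η' : Config E),
      F (Function.update η e true) (Function.update η' e true) -
          F (Function.update η e true) (Function.update η' e false) -
          F (Function.update η e false) (Function.update η' e true) +
          F (Function.update η e false) (Function.update η' e false) ≤ 0)
    {p : E → ℝ} (hp : IsProb p) : 0 ≤ dsum (weight p) (weight p) F :=
  induction_free (P := fun q => 0 ≤ dsum (weight q) (weight q) F)
    (fun σ => by rw [dsum_detWeights]; exact hdiag σ)
    (fun q e hq h1 h0 => dsum_step hq e F (hF e) h1 h0) hp

end DoubleSum

/-! ### The SMC kernel along the transitions of one edge -/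

namespace MultiGraph

variable {V E : Type*} (G : MultiGraph V E) [DecidableEq E]

/-- The second difference of an SMC kernel along the transitions caused by one edge is `≤ 0`. -/
theorem smc_second_difference_nonpos {k : ℕ} (m : Fin k → V)
    {A : Setoid (Fin k) → Setoid (Fin k) → ℝ} (hA : SMC A) (e : E) (η η' : Config E) :
    A (G.markedPartition (Function.update η e true) m)
          (G.markedPartition (Function.update η' e true) m) -
        A (G.markedPartition (Function.update η e true) m)
          (G.markedPartition (Function.update η' e false) m) -
        A (G.markedPartition (Function.update η e false) m)
          (G.markedPartition (Function.update η' e true) m) +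
        A (G.markedPartition (Function.update η e false) m)
          (G.markedPartition (Function.update η' e false) m) ≤ 0 := by
  have hη : Function.update η e true = Function.update (Function.update η e false) e true := by
    rw [Function.update_idem]
  have hη' : Function.update η' e true = Function.update (Function.update η' e false) e true := by
    rw [Function.update_idem]
  rw [hη, hη']
  rcases G.markedPartition_update_true (Function.update η e false) e m with h | h
  · rw [h]
    linarith
  · rcases G.markedPartition_update_true (Function.update η' e false) e m with h' | h'
    · rw [h']
      linarith
    · exact hA.merge_nonpos _ _ _ _ h h'

variable [Fintype E]

/-- The quadratic form of a kernel is the double sum of `A ∘ (Π, Π)`. -/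
theorem quadForm_eq_dsum (p : E → ℝ) {k : ℕ} (m : Fin k → V)
    (A : Setoid (Fin k) → Setoid (Fin k) → ℝ) :
    G.quadForm p m A =
      dsum (weight p) (weight p) fun ω ω' => A (G.markedPartition ω m) (G.markedPartition ω' m) :=
  rfl

/-- **The SMC principle**: for an SMC kernel `A`, the quadratic form `Q_A` at the law of the
marked partition is nonnegative, for every finite multigraph, every `p ∈ [0, 1]^E` and every
marking `m`. -/
theorem quadForm_nonneg_of_smc {p : E → ℝ} (hp : IsProb p) {k : ℕ} (m : Fin k → V)
    {A : Setoid (Fin k) → Setoid (Fin k) → ℝ} (hA : SMC A) : 0 ≤ G.quadForm p m A := by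
  rw [quadForm_eq_dsum]
  exact dsum_nonneg_of_second_difference _ (fun ω => hA.diag_nonneg _)
    (fun e η η' => G.smc_second_difference_nonpos m hA e η η') hp

end MultiGraph

/-- **The SMC principle** holds for every number `k` of marked vertices
(`proofs/P4-pairsum.md` Theorem 7). -/
theorem smc_principle (k : ℕ) : SMCPrinciple k :=
  fun G _ hp m _ hA => G.quadForm_nonneg_of_smc hp m hA

end PercRepro
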